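import Literature.NumberTheory.Automorphic.AdelicPoissonSummation
import HarnessLib

/-!
# Adelic Fourier coefficients of translation-invariant functions vanish off the annihilator

Topic `NumberTheory/Automorphic`. Sequel to `AdelicPoissonSummation` (`adeleFourierCoeff`,
`piFourierCoeff`: `F̂(ξ) = ∫ F(v) ψ(∑ᵢ ξᵢ vᵢ) dν(v)` for `ξ ∈ K^ι`, `ψ = adeleAddChar K`). The first,
purely formal, half of the finite-adelic side of the Schwartz estimates for the basic estimate on
cusp forms (Garrett (2018), proof of Thm. 7.3.10, PDF p. 340: the Fourier transforms of the
`H`-invariant functions `φ_{x,y}` vanish at `ψ_ξ` unless `ξ_fin` lies in a compact `U`, "Thus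
`ξ ∈ (1/h) 𝔫_𝔬`"; Getz–Hahn (2024), Prop. 9.5.3, the factor `𝟙_{Ω_𝔫^∞}(η)`): **if `F` is invariant
under translation by `h` then `F̂(ξ) = ψ(⟨ξ, h⟩) F̂(ξ)`, so `F̂(ξ) = 0` unless `ψ(⟨ξ, h⟩) = 1`** — by the
translation invariance of the Haar measure. Hence for `F` invariant under a subgroup `H` (e.g. a
compact open subgroup of the finite adeles, as every test function is) the coefficients are
supported on the annihilator `{ξ : ψ(⟨ξ, h⟩) = 1 ∀ h ∈ H}`. Everything is proved (Mathlib
`MeasureTheory.integral_add_right_eq_self`); the arithmetic half — the annihilator of a compact open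
subgroup meets `K^ι` in a lattice — is left to a sibling file.

* `piFourierCoeff_eq_mul_of_forall_add_eq`, `piFourierCoeff_eq_zero_of_forall_add_eq`,
  `piFourierCoeff_eq_zero_of_invariant` (subgroup form); and the one-variable versions
  `adeleFourierCoeff_eq_mul_of_forall_add_eq`, `adeleFourierCoeff_eq_zero_of_forall_add_eq`.

## References

* P. Garrett, *Modern Analysis of Automorphic Forms by Example* (2018), §7.3, proof of Thm. 7.3.10,
  PDF p. 340 [Garrett2018].
* J. R. Getz, H. Hahn, *An Introduction to Automorphic Representations* (2024), Prop. 9.5.3,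
  printed pp. 187–188 [GetzHahn2024].
-/

noncomputable section

open MeasureTheory Measure NumberField IsDedekindDomain

namespace Literature.NumberTheory.Automorphic

section Pi

variable {K : Type} [Field K] [NumberField K] {ι : Type} [Fintype ι]
  [MeasurableSpace (AdeleRing (𝓞 K) K)] [BorelSpace (AdeleRing (𝓞 K) K)]
  (ν : Measure (ι → AdeleRing (𝓞 K) K)) [ν.IsAddRightInvariant]

/-- **Translation covariance of adelic Fourier coefficients**: if `F(v + h) = F(v)` for all `v`
then `F̂(ξ) = ψ(⟨ξ, h⟩) · F̂(ξ)` (substitute `v ↦ v + h` in the Haar integral). [folklore] -/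
theorem piFourierCoeff_eq_mul_of_forall_add_eq {F : (ι → AdeleRing (𝓞 K) K) → ℂ}
    {h : ι → AdeleRing (𝓞 K) K} (hF : ∀ v, F (v + h) = F v) (ξ : ι → K) :
    piFourierCoeff ν F ξ =
      (adeleAddChar K (∑ i, algebraMap K (AdeleRing (𝓞 K) K) (ξ i) * h i) : ℂ) *
        piFourierCoeff ν F ξ := by
  rw [piFourierCoeff_apply]
  conv_lhs => rw [← integral_add_right_eq_self _ h]
  simp only [hF, Pi.add_apply, mul_add, Finset.sum_add_distrib, AddChar.map_add_eq_mul,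
    Circle.coe_mul]
  rw [← integral_const_mul]
  refine integral_congr_ae (Filter.Eventually.of_forall fun v => ?_)
  ring

/-- **Vanishing off the annihilator**: if `F(v + h) = F(v)` for all `v` and `ψ(⟨ξ, h⟩) ≠ 1` then
`F̂(ξ) = 0`. [cite: Garrett2018, §7.3 proof of Thm. 7.3.10 (PDF p. 340)] -/
theorem piFourierCoeff_eq_zero_of_forall_add_eq {F : (ι → AdeleRing (𝓞 K) K) → ℂ}
    {h : ι → AdeleRing (𝓞 K) K} (hF : ∀ v, F (v + h) = F v) {ξ : ι → K}
    (hψ : adeleAddChar K (∑ i, algebraMap K (AdeleRing (𝓞 K) K) (ξ i) * h i) ≠ 1) :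
    piFourierCoeff ν F ξ = 0 := by
  have e := piFourierCoeff_eq_mul_of_forall_add_eq ν hF ξ
  have hne : ((adeleAddChar K (∑ i, algebraMap K (AdeleRing (𝓞 K) K) (ξ i) * h i) : ℂ)) ≠ 1 := by
    rwa [Ne, Circle.coe_eq_one]
  have : (1 - (adeleAddChar K (∑ i, algebraMap K (AdeleRing (𝓞 K) K) (ξ i) * h i) : ℂ)) *
      piFourierCoeff ν F ξ = 0 := by
    rw [sub_mul, one_mul, ← e, sub_self]
  exact (mul_eq_zero.1 this).resolve_left (sub_ne_zero.2 hne.symm)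

/-- **Fourier coefficients of an `H`-invariant function are supported on the annihilator of `H`**:
if `F(v + h) = F(v)` for all `v` and all `h` in a set `H`, then `F̂(ξ) ≠ 0` forces
`ψ(⟨ξ, h⟩) = 1` for every `h ∈ H`. [cite: Garrett2018, §7.3 proof of Thm. 7.3.10 (PDF p. 340)] -/
theorem forall_adeleAddChar_eq_one_of_piFourierCoeff_ne_zero {F : (ι → AdeleRing (𝓞 K) K) → ℂ}
    {H : Set (ι → AdeleRing (𝓞 K) K)} (hF : ∀ h ∈ H, ∀ v, F (v + h) = F v) {ξ : ι → K}
    (hξ : piFourierCoeff ν F ξ ≠ 0) :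
    ∀ h ∈ H, adeleAddChar K (∑ i, algebraMap K (AdeleRing (𝓞 K) K) (ξ i) * h i) = 1 := by
  intro h hh
  by_contra hne
  exact hξ (piFourierCoeff_eq_zero_of_forall_add_eq ν (hF h hh) hne)

end Pi

section One

variable {K : Type} [Field K] [NumberField K]
  [MeasurableSpace (AdeleRing (𝓞 K) K)] [BorelSpace (AdeleRing (𝓞 K) K)]
  (μ : Measure (AdeleRing (𝓞 K) K)) [μ.IsAddRightInvariant]

/-- One-variable translation covariance: `F(x + h) = F(x)` for all `x` gives
`F̂(ξ) = ψ(ξ h) · F̂(ξ)`. [folklore] -/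
theorem adeleFourierCoeff_eq_mul_of_forall_add_eq {F : AdeleRing (𝓞 K) K → ℂ}
    {h : AdeleRing (𝓞 K) K} (hF : ∀ x, F (x + h) = F x) (ξ : K) :
    adeleFourierCoeff μ F ξ =
      (adeleAddChar K (algebraMap K (AdeleRing (𝓞 K) K) ξ * h) : ℂ) * adeleFourierCoeff μ F ξ := by
  rw [adeleFourierCoeff_apply]
  conv_lhs => rw [← integral_add_right_eq_self _ h]
  simp only [hF, mul_add, AddChar.map_add_eq_mul, Circle.coe_mul]
  rw [← integral_const_mul]
  refine integral_congr_ae (Filter.Eventually.of_forall fun v => ?_)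
  ring

/-- One-variable vanishing off the annihilator: `F(x + h) = F(x)` for all `x` and `ψ(ξ h) ≠ 1` give
`F̂(ξ) = 0`. [cite: Garrett2018, §7.3 proof of Thm. 7.3.10 (PDF p. 340)] -/
theorem adeleFourierCoeff_eq_zero_of_forall_add_eq {F : AdeleRing (𝓞 K) K → ℂ}
    {h : AdeleRing (𝓞 K) K} (hF : ∀ x, F (x + h) = F x) {ξ : K}
    (hψ : adeleAddChar K (algebraMap K (AdeleRing (𝓞 K) K) ξ * h) ≠ 1) :
    adeleFourierCoeff μ F ξ = 0 := by
  have e := adeleFourierCoeff_eq_mul_of_forall_add_eq μ hF ξ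
  have hne : ((adeleAddChar K (algebraMap K (AdeleRing (𝓞 K) K) ξ * h) : ℂ)) ≠ 1 := by
    rwa [Ne, Circle.coe_eq_one]
  have : (1 - (adeleAddChar K (algebraMap K (AdeleRing (𝓞 K) K) ξ * h) : ℂ)) *
      adeleFourierCoeff μ F ξ = 0 := by
    rw [sub_mul, one_mul, ← e, sub_self]
  exact (mul_eq_zero.1 this).resolve_left (sub_ne_zero.2 hne.symm)

end One

end Literature.NumberTheory.Automorphic
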